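import Summits.AtomisticToContinuum.Crystallization.Theorems.FreeSplittingCertificatesStrictSplittingRuleDefs
import Summits.AtomisticToContinuum.Crystallization.Theorems.PalmUnimodularRigidityLayeredLawsSelectHcpDefs

/-!
# `StrictSplittingRule` (stmt-AtomisticToContinuum-12560), line `birth`: the three-piece split of the perturbative core (reshape r3)

Route `FreeSplittingCertificates`, crux r3 `StrictSplittingRule`, line `birth`.  After reshape r2 the perturbative
half of the line is the core hypothesis `PerturbativeCore δ a t η₀ e(hcp(a,h))` (Defs file): sitewise,
finite-range-redistributed coercivity of the relaxed Lennard-Jones hcp crystal on the good–good subgraph at ZERO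
budget.  The wave-2 worker's kill analysis found no counterexample (Hall inequality `|S|·e ≤ E(S)` on good
clusters, sibling file `…CoreHall.lean`) and isolated THREE PIECES, stated here over the tree's hcp site map
`hcpSite a h : ℤ³ → ℝ³` and `W′ = ljSqDeriv` (`PalmUnimodularRigidityLayeredLawsSelectHcpDefs`):

* `CoreFirstOrderDesign a h` (H1, stub `stub_coreFirstOrderDesign`): a Bravais-covariant, finitely-stencilled,
  `(1+r)⁻⁶`-decaying antisymmetric LINEAR bond transfer cancelling the naive half-split first variation at every
  site (zero virial stress ⇐ `HcpFamilyMin`, internal equilibrium by site symmetry; augmentation-ideal algebra +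
  exterior truss) — believed provable now;
* `CoreSitewiseHarmonic a h` (H2, stub `stub_coreSitewiseHarmonic`): quadratic transfers making the second
  variation SITEWISE coercive in the nearest-neighbour stretches — a local sum-of-squares decomposition of the hcp
  force constants modulo rigid motions; OPEN, at least as hard as crux `PhononStability` (stmt-…-9333, the global
  inequality), which does not imply it;
* `CoreAssembly a h` (H3, stub `stub_coreAssembly : ∀ a h, CoreAssembly a h`): H1 → H2 → core (rule `½ + λ`, charts of all-good regions, cubic
  remainders up to `η₀ = a/100`, defect slack, far tails).

`stub_perturbativeCoreOfPieces` (registered anchor, proved): the registered signature of `stub_perturbativeCore`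
follows verbatim from H1, H2 (at family minimisers) and H3.  These are line-internal PROOF OBLIGATIONS (each asserted
by its own registered stub), not facts; nothing landed assumes them.  All [folklore] bookkeeping.
-/

noncomputable section

namespace Summit.AtomisticToContinuum.Crystallization.Theorems.StrictSplittingRuleBirth

open scoped BigOperators Classical
open Literature.MathematicalPhysics.StatisticalMechanics
open Literature.Geometry.DiscreteGeometry
open Summit.AtomisticToContinuum.Crystallization.Theorems.PalmUnimodularRigidity.LayeredLawsSelectHcp
  (hcpSite ljSqDeriv)

/-- Euclidean `3`-space. -/
local notation "E3" => EuclideanSpace ℝ (Fin 3)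

/-! ## The three pieces -/

/-- **H1 — first-order design (radial, frame-free).**  Sites `y = hcpSite a h : ℤ³ → ℝ³`, parity `b(p) =
[layer even]`, stencil readout `dl u p s = ⟨y_{p+s} − y_p, u_{p+s} − u_p⟩` (first-order change of the bond
length², up to the factor 2).  There are a finite stencil `Y`, Bravais-covariant coefficients
`β(b(p), q − p, s)` with `|β| ≤ C(1 + ‖y_q − y_p‖)⁻⁶`, such that for every finitely supported displacement
field `u` and every site `p` the naive half-split first variation plus the antisymmetrised transfers vanishes:
`Σ'_{q ≠ p} W′(‖y_q−y_p‖²)⟨y_q−y_p, u_q−u_p⟩ + Σ'_{q ≠ p} Σ_{s ∈ Y} [β(b p)(q−p)(s)·dl u p s − β(b q)(p−q)(s)·dl u q s] = 0`.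
(Line-internal proof obligation, stub `stub_coreFirstOrderDesign`.) [folklore] -/
def CoreFirstOrderDesign (a h : ℝ) : Prop :=
  ∃ (Y : Finset (ℤ × ℤ × ℤ)) (β : Bool → (ℤ × ℤ × ℤ) → (ℤ × ℤ × ℤ) → ℝ) (C : ℝ),
    (∀ b d s, s ∉ Y → β b d s = 0) ∧
    (∀ p q : ℤ × ℤ × ℤ, ∀ s, |β (decide (Even p.1)) (q - p) s| ≤
        C * ((1 + ‖hcpSite a h q - hcpSite a h p‖)⁻¹) ^ 6) ∧
    ∀ u : ℤ × ℤ × ℤ → E3, (Function.support u).Finite → ∀ p : ℤ × ℤ × ℤ,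
      (∑' q : ℤ × ℤ × ℤ, (if q = p then (0 : ℝ) else
          ljSqDeriv (‖hcpSite a h q - hcpSite a h p‖ ^ 2) *
            inner ℝ (hcpSite a h q - hcpSite a h p) (u q - u p))) +
      (∑' q : ℤ × ℤ × ℤ, (if q = p then (0 : ℝ) else
          ∑ s ∈ Y, (β (decide (Even p.1)) (q - p) s *
              inner ℝ (hcpSite a h (p + s) - hcpSite a h p) (u (p + s) - u p) -
            β (decide (Even q.1)) (p - q) s *
              inner ℝ (hcpSite a h (q + s) - hcpSite a h q) (u (q + s) - u q)))) = 0

/-- **H2 — sitewise harmonic coercivity (radial quadratic transfers).**  With `W′ = ljSqDeriv`,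
`W″(σ) = ½(7σ⁻⁸ − 4σ⁻⁵)`, there are `κ > 0`, a finite stencil `Y`, Bravais-covariant quadratic transfer
coefficients `M` (both stretches read at the sending end) and `N` (one stretch at each end; the bond transfer
`(N(b p)(q−p)(s,s′) − N(b q)(p−q)(s′,s))·dl u p s·dl u q s′` is antisymmetric by construction), both
`≤ C(1 + ‖y_q − y_p‖)⁻⁶`, such that for every finitely supported `u` and every site `p`:
`κ·Σ'_{0 < ‖y_q−y_p‖ ≤ 1.1a} ⟨y_q−y_p, u_q−u_p⟩² ≤ ½Σ'_{q≠p}[W′‖u_q−u_p‖² + 2W″⟨y_q−y_p,u_q−u_p⟩²]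
  + Σ'_{q≠p} Σ_{s,s′∈Y} [M(b p)(q−p)(s,s′)·dl u p s·dl u p s′ − M(b q)(p−q)(s,s′)·dl u q s·dl u q s′
                         + (N(b p)(q−p)(s,s′) − N(b q)(p−q)(s′,s))·dl u p s·dl u q s′]`
(naive half-split second variation of `Σ_q V(‖y_q + u_q − y_p − u_p‖)` plus every antisymmetric transfer a rule
reading the two endpoint shells can make at second order, coercive in the nearest-neighbour bond stretches).
OPEN (local SOS decomposition of the hcp dynamical matrix modulo rigid motions); line-internal proof obligation,
stub `stub_coreSitewiseHarmonic`. [folklore] -/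
def CoreSitewiseHarmonic (a h : ℝ) : Prop :=
  ∃ (κ C : ℝ) (Y : Finset (ℤ × ℤ × ℤ))
    (M N : Bool → (ℤ × ℤ × ℤ) → (ℤ × ℤ × ℤ) → (ℤ × ℤ × ℤ) → ℝ),
    0 < κ ∧
    (∀ b d s s', s ∉ Y ∨ s' ∉ Y → M b d s s' = 0 ∧ N b d s s' = 0) ∧
    (∀ p q : ℤ × ℤ × ℤ, ∀ s s', |M (decide (Even p.1)) (q - p) s s'| ≤
        C * ((1 + ‖hcpSite a h q - hcpSite a h p‖)⁻¹) ^ 6 ∧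
      |N (decide (Even p.1)) (q - p) s s'| ≤ C * ((1 + ‖hcpSite a h q - hcpSite a h p‖)⁻¹) ^ 6) ∧
    ∀ u : ℤ × ℤ × ℤ → E3, (Function.support u).Finite → ∀ p : ℤ × ℤ × ℤ,
      κ * (∑' q : ℤ × ℤ × ℤ,
          (if 0 < ‖hcpSite a h q - hcpSite a h p‖ ∧ ‖hcpSite a h q - hcpSite a h p‖ ≤ 11 / 10 * a then
            (inner ℝ (hcpSite a h q - hcpSite a h p) (u q - u p)) ^ 2 else (0 : ℝ))) ≤
      (∑' q : ℤ × ℤ × ℤ, (if q = p then (0 : ℝ) else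
          1 / 2 * (ljSqDeriv (‖hcpSite a h q - hcpSite a h p‖ ^ 2) * ‖u q - u p‖ ^ 2 +
            2 * (1 / 2 * (7 * ((‖hcpSite a h q - hcpSite a h p‖ ^ 2)⁻¹) ^ 8 -
              4 * ((‖hcpSite a h q - hcpSite a h p‖ ^ 2)⁻¹) ^ 5)) *
              (inner ℝ (hcpSite a h q - hcpSite a h p) (u q - u p)) ^ 2))) +
      (∑' q : ℤ × ℤ × ℤ, (if q = p then (0 : ℝ) else
          ∑ s ∈ Y, ∑ s' ∈ Y,
            (M (decide (Even p.1)) (q - p) s s' *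
                (inner ℝ (hcpSite a h (p + s) - hcpSite a h p) (u (p + s) - u p) *
                  inner ℝ (hcpSite a h (p + s') - hcpSite a h p) (u (p + s') - u p)) -
              M (decide (Even q.1)) (p - q) s s' *
                (inner ℝ (hcpSite a h (q + s) - hcpSite a h q) (u (q + s) - u q) *
                  inner ℝ (hcpSite a h (q + s') - hcpSite a h q) (u (q + s') - u q)) +
              (N (decide (Even p.1)) (q - p) s s' - N (decide (Even q.1)) (p - q) s' s) *
                (inner ℝ (hcpSite a h (p + s) - hcpSite a h p) (u (p + s) - u p) *
                  inner ℝ (hcpSite a h (q + s') - hcpSite a h q) (u (q + s') - u q)))))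

/-- **H3 — the assembly at `(a, h)`**: from the first-order design and the sitewise harmonic coercivity at the
family minimiser `(a, h)` to the core, for every hard core, stretch label and tolerance `η₀ ≤ a/100` (rule `½ + λ` with `λ` the
antisymmetrised shell-read transfer; charts of all-good regions; cubic remainders; defect slack; far tails).
Line-internal proof obligation, stub `stub_coreAssembly`. [folklore] -/
def CoreAssembly (a h : ℝ) : Prop :=
  0 < a → 0 < h → HcpFamilyMin a h → CoreFirstOrderDesign a h → CoreSitewiseHarmonic a h →
    ∀ δ : ℝ, 0 < δ → ∀ t η₀ : ℝ, |t| ≤ 1 / 100 → h = (1 + t) * a * Real.sqrt (2 / 3) →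
      ∀ (ha : a ≠ 0) (hh : h ≠ 0), 0 < η₀ → η₀ ≤ a / 100 →
        PerturbativeCore δ a t η₀ ((hcpPeriodicConfiguration ha hh).energyPerParticle lennardJones)

/-- **Registered anchor `stub_perturbativeCoreOfPieces`: the registered signature of `stub_perturbativeCore`,
VERBATIM, from the three pieces** (H1 and H2 only at family minimisers).  `h > 0` is recovered from `h = (1 + t) a √(2/3)`, `|t| ≤ 1/100`, `a > 0`. -/
theorem stub_perturbativeCoreOfPieces :
    (∀ a h : ℝ, 0 < a → 0 < h → HcpFamilyMin a h → CoreFirstOrderDesign a h) →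
    (∀ a h : ℝ, 0 < a → 0 < h → HcpFamilyMin a h → CoreSitewiseHarmonic a h) →
    (∀ a h : ℝ, CoreAssembly a h) →
    ∀ δ : ℝ, 0 < δ → ∀ a h t η₀ : ℝ, 0 < a → |t| ≤ 1 / 100 →
      h = (1 + t) * a * Real.sqrt (2 / 3) → HcpFamilyMin a h → ∀ (ha : a ≠ 0) (hh : h ≠ 0),
        0 < η₀ → η₀ ≤ a / 100 →
          PerturbativeCore δ a t η₀ ((hcpPeriodicConfiguration ha hh).energyPerParticle lennardJones) := by
  intro h1 h2 h3 δ hδ a h t η₀ ha ht hht hfam ha' hh' hη₀ hη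
  have hpos : 0 < h := by
    have h1t : 0 < 1 + t := by have := (abs_le.1 ht).1; linarith
    rw [hht]
    exact mul_pos (mul_pos h1t ha) (Real.sqrt_pos.2 (by norm_num))
  exact h3 a h ha hpos hfam (h1 a h ha hpos hfam) (h2 a h ha hpos hfam) δ hδ t η₀ ht hht ha' hh' hη₀ hη

/-! ## Reshape r4 (lead c4, 2026-08-17): quantitative sitewise coercivity H2′ and quantitative assembly H3′

Why (item evidence `ASSEMBLY-ARCHITECTURE.md`, `SOS-NUMERICS.md`): (1) the coercive norm of H2 (the twelve radial
first-shell stretches) cannot yield strictness — the 13-site first-shell framework has an infinitesimal flex — so H2′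
bounds below by `κ ·` the squared `ℓ²`-distance of the first shell's relative displacement from the infinitesimal
RIGID MOTIONS `d ↦ c + W d` (`W` skew), which is what `ShellCloseTo` linearises to; (2) the `κ` of H2 was
existential, so no fixed tolerance could be derived from it (wave-3 verdict `stub-misstated` on H3): H2′ carries `κ`
as a PARAMETER, the registered stub asserts an explicit numeral validated by the sitewise-SOS semidefinite programme
(`κ_site` against `κ_glob = 1.93`), and H3′ takes H1 ∧ H2′(κ₀) to the core for tolerances `η₀ ≤ a/N₀` with both
constants explicit.  The r3 definitions above stay (landed, referenced); the skeleton switches to the primed pieces.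
-/

/-- **H2′ — sitewise harmonic COERCIVITY MODULO RIGID MOTIONS, constant `κ`.**  The same naive half-split second
variation of `Σ_q V(‖y_q + u_q − y_p − u_p‖)` (`W′ = ljSqDeriv`, `W″(σ) = ½(7σ⁻⁸ − 4σ⁻⁵)`) and the same
Bravais-covariant, `(1+r)⁻⁶`-decaying antisymmetric quadratic transfers `M` (one end's stencil stretches) and `N`
(one stretch at each end) over a finite stencil `Y` as `CoreSitewiseHarmonic`; the lower bound is
`κ · Σ'_{0 < ‖y_q−y_p‖ ≤ 1.1a} ‖u_q − u_p − c − W(y_q − y_p)‖²` for SOME translation `c` and skew `W` (depending on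
`u` and `p`): every site's transferred second variation dominates the squared distance of its first shell's
displacement from the infinitesimal rigid motions.  With decaying transfers of unbounded range this is, by convex
duality against stationary displacement fields, the sitewise form of global phonon stability (constant at most
`κ_glob`); with finite-range transfers it is false for every `κ` (far longitudinal pair stiffness `−3.5 r⁻⁸ < 0`).
Line-internal proof obligation (stub `stub_coreSitewiseCoercive`, explicit `κ`). [folklore] -/
def CoreSitewiseCoercive (a h κ : ℝ) : Prop :=
  ∃ (C : ℝ) (Y : Finset (ℤ × ℤ × ℤ))
    (M N : Bool → (ℤ × ℤ × ℤ) → (ℤ × ℤ × ℤ) → (ℤ × ℤ × ℤ) → ℝ),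
    (∀ b d s s', s ∉ Y ∨ s' ∉ Y → M b d s s' = 0 ∧ N b d s s' = 0) ∧
    (∀ p q : ℤ × ℤ × ℤ, ∀ s s', |M (decide (Even p.1)) (q - p) s s'| ≤
        C * ((1 + ‖hcpSite a h q - hcpSite a h p‖)⁻¹) ^ 6 ∧
      |N (decide (Even p.1)) (q - p) s s'| ≤ C * ((1 + ‖hcpSite a h q - hcpSite a h p‖)⁻¹) ^ 6) ∧
    ∀ u : ℤ × ℤ × ℤ → E3, (Function.support u).Finite → ∀ p : ℤ × ℤ × ℤ,
      ∃ (c : E3) (W : E3 →ₗ[ℝ] E3), (∀ z : E3, inner ℝ (W z) z = 0) ∧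
      κ * (∑' q : ℤ × ℤ × ℤ,
          (if 0 < ‖hcpSite a h q - hcpSite a h p‖ ∧ ‖hcpSite a h q - hcpSite a h p‖ ≤ 11 / 10 * a then
            ‖u q - u p - c - W (hcpSite a h q - hcpSite a h p)‖ ^ 2 else (0 : ℝ))) ≤
      (∑' q : ℤ × ℤ × ℤ, (if q = p then (0 : ℝ) else
          1 / 2 * (ljSqDeriv (‖hcpSite a h q - hcpSite a h p‖ ^ 2) * ‖u q - u p‖ ^ 2 +
            2 * (1 / 2 * (7 * ((‖hcpSite a h q - hcpSite a h p‖ ^ 2)⁻¹) ^ 8 -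
              4 * ((‖hcpSite a h q - hcpSite a h p‖ ^ 2)⁻¹) ^ 5)) *
              (inner ℝ (hcpSite a h q - hcpSite a h p) (u q - u p)) ^ 2))) +
      (∑' q : ℤ × ℤ × ℤ, (if q = p then (0 : ℝ) else
          ∑ s ∈ Y, ∑ s' ∈ Y,
            (M (decide (Even p.1)) (q - p) s s' *
                (inner ℝ (hcpSite a h (p + s) - hcpSite a h p) (u (p + s) - u p) *
                  inner ℝ (hcpSite a h (p + s') - hcpSite a h p) (u (p + s') - u p)) -
              M (decide (Even q.1)) (p - q) s s' *
                (inner ℝ (hcpSite a h (q + s) - hcpSite a h q) (u (q + s) - u q) *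
                  inner ℝ (hcpSite a h (q + s') - hcpSite a h q) (u (q + s') - u q)) +
              (N (decide (Even p.1)) (q - p) s s' - N (decide (Even q.1)) (p - q) s' s) *
                (inner ℝ (hcpSite a h (p + s) - hcpSite a h p) (u (p + s) - u p) *
                  inner ℝ (hcpSite a h (q + s') - hcpSite a h q) (u (q + s') - u q)))))

/-- H2′ is ANTITONE in its constant: a smaller `κ' ≤ κ` is implied (the rigid-motion distance term is `≥ 0`). -/
theorem coreSitewiseCoercive_mono {a h κ κ' : ℝ} (hκ : κ' ≤ κ) :
    CoreSitewiseCoercive a h κ → CoreSitewiseCoercive a h κ' := by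
  rintro ⟨C, Y, M, N, hY, hdec, hu⟩
  refine ⟨C, Y, M, N, hY, hdec, fun u hfin p => ?_⟩
  obtain ⟨c, W, hW, hle⟩ := hu u hfin p
  refine ⟨c, W, hW, le_trans ?_ hle⟩
  have hnn : 0 ≤ ∑' q : ℤ × ℤ × ℤ,
      (if 0 < ‖hcpSite a h q - hcpSite a h p‖ ∧ ‖hcpSite a h q - hcpSite a h p‖ ≤ 11 / 10 * a then
        ‖u q - u p - c - W (hcpSite a h q - hcpSite a h p)‖ ^ 2 else (0 : ℝ)) :=
    tsum_nonneg fun q => by split_ifs <;> positivity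
  exact mul_le_mul_of_nonneg_right hκ hnn

/-- **H3′ — the quantitative assembly at `(a, h)`** with explicit coercivity constant `κ₀` and tolerance fraction
`1/N₀`: from H1 (`CoreFirstOrderDesign`) and H2′ (`CoreSitewiseCoercive a h κ₀`) at the family minimiser to the
core `PerturbativeCore δ a t η₀ e(hcp(a,h))` for every hard core `δ`, stretch label `t` and tolerance
`η₀ ≤ a/N₀` (rule `½ + θ`: equivariantly averaged near-field design, geometric far-field design — density transfer
at first order, `c r⁻⁶ Σ_s stretch²` exports at second order; charts of two-shell-good regions; cubic remainders;
excluded bad layers dominate discreteness and truncation residuals).  Line-internal proof obligation (stub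
`stub_coreAssemblyQ`). [folklore] -/
def CoreAssemblyQ (κ₀ N₀ a h : ℝ) : Prop :=
  0 < a → 0 < h → HcpFamilyMin a h → CoreFirstOrderDesign a h → CoreSitewiseCoercive a h κ₀ →
    ∀ δ : ℝ, 0 < δ → ∀ t η₀ : ℝ, |t| ≤ 1 / 100 → h = (1 + t) * a * Real.sqrt (2 / 3) →
      ∀ (ha : a ≠ 0) (hh : h ≠ 0), 0 < η₀ → η₀ ≤ a / N₀ →
        PerturbativeCore δ a t η₀ ((hcpPeriodicConfiguration ha hh).energyPerParticle lennardJones)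

/-- **Registered anchor `stub_perturbativeCoreOfPiecesQ` (reshape r4): the core from the primed pieces, at
tolerance fraction `1/N₀`** — H1 and H2′(κ₀) at family minimisers and H3′(κ₀, N₀) give
`PerturbativeCore δ a t η₀ e(hcp(a,h))` for all `0 < η₀ ≤ a/N₀`. -/
theorem stub_perturbativeCoreOfPiecesQ : ∀ κ₀ N₀ : ℝ,
    (∀ a h : ℝ, 0 < a → 0 < h → HcpFamilyMin a h → CoreFirstOrderDesign a h) →
    (∀ a h : ℝ, 0 < a → 0 < h → HcpFamilyMin a h → CoreSitewiseCoercive a h κ₀) →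
    (∀ a h : ℝ, CoreAssemblyQ κ₀ N₀ a h) →
    ∀ δ : ℝ, 0 < δ → ∀ a h t η₀ : ℝ, 0 < a → |t| ≤ 1 / 100 →
      h = (1 + t) * a * Real.sqrt (2 / 3) → HcpFamilyMin a h → ∀ (ha : a ≠ 0) (hh : h ≠ 0),
        0 < η₀ → η₀ ≤ a / N₀ →
          PerturbativeCore δ a t η₀ ((hcpPeriodicConfiguration ha hh).energyPerParticle lennardJones) := by
  intro κ₀ N₀ h1 h2 h3 δ hδ a h t η₀ ha ht hht hfam ha' hh' hη₀ hη
  have hpos : 0 < h := by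
    have h1t : 0 < 1 + t := by have := (abs_le.1 ht).1; linarith
    rw [hht]
    exact mul_pos (mul_pos h1t ha) (Real.sqrt_pos.2 (by norm_num))
  exact h3 a h ha hpos hfam (h1 a h ha hpos hfam) (h2 a h ha hpos hfam) δ hδ t η₀ ht hht ha' hh' hη₀ hη

/-! ### r4, recentred form (the one the skeleton uses)

`CoreSitewiseCoercive` lets a free translation `c` absorb the displacement of the first shell relative to its
centre ("rattling"), which `ShellCloseTo` — a statement about the shell RECENTRED at the actual centre — does not
forgive, and which enters the cubic remainders at first order.  The recentred form below drops `c` (translations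
are already factored out by using differences `u_q − u_p`): its left-hand side is `κ ·` the squared distance of the
recentred shell displacement from the infinitesimal ROTATIONS, literally the linearisation of the strictness
target.  It implies the free-`c` form (`coreSitewiseCoercive_of_shell`, take `c = 0`); the SDP numerics pin its
constant (rattling is the stiff Einstein mode, `½·𝒟 ≈ 9.9·I`, so the two constants are comparable).
-/

/-- **H2″ — RECENTRED sitewise harmonic coercivity, constant `κ`** (the registered form of H2 after reshape r4):
as `CoreSitewiseCoercive`, but the lower bound is `κ · Σ'_{0 < ‖y_q−y_p‖ ≤ 1.1a} ‖u_q − u_p − W(y_q − y_p)‖²` for some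
skew `W` only (no free translation): the transferred second variation of every site dominates the squared distance
of its RECENTRED first-shell displacement from the infinitesimal rotations.  Line-internal proof obligation (stub
`stub_coreShellCoercive`, explicit `κ`). [folklore] -/
def CoreShellCoercive (a h κ : ℝ) : Prop :=
  ∃ (C : ℝ) (Y : Finset (ℤ × ℤ × ℤ))
    (M N : Bool → (ℤ × ℤ × ℤ) → (ℤ × ℤ × ℤ) → (ℤ × ℤ × ℤ) → ℝ),
    (∀ b d s s', s ∉ Y ∨ s' ∉ Y → M b d s s' = 0 ∧ N b d s s' = 0) ∧
    (∀ p q : ℤ × ℤ × ℤ, ∀ s s', |M (decide (Even p.1)) (q - p) s s'| ≤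
        C * ((1 + ‖hcpSite a h q - hcpSite a h p‖)⁻¹) ^ 6 ∧
      |N (decide (Even p.1)) (q - p) s s'| ≤ C * ((1 + ‖hcpSite a h q - hcpSite a h p‖)⁻¹) ^ 6) ∧
    ∀ u : ℤ × ℤ × ℤ → E3, (Function.support u).Finite → ∀ p : ℤ × ℤ × ℤ,
      ∃ W : E3 →ₗ[ℝ] E3, (∀ z : E3, inner ℝ (W z) z = 0) ∧
      κ * (∑' q : ℤ × ℤ × ℤ,
          (if 0 < ‖hcpSite a h q - hcpSite a h p‖ ∧ ‖hcpSite a h q - hcpSite a h p‖ ≤ 11 / 10 * a then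
            ‖u q - u p - W (hcpSite a h q - hcpSite a h p)‖ ^ 2 else (0 : ℝ))) ≤
      (∑' q : ℤ × ℤ × ℤ, (if q = p then (0 : ℝ) else
          1 / 2 * (ljSqDeriv (‖hcpSite a h q - hcpSite a h p‖ ^ 2) * ‖u q - u p‖ ^ 2 +
            2 * (1 / 2 * (7 * ((‖hcpSite a h q - hcpSite a h p‖ ^ 2)⁻¹) ^ 8 -
              4 * ((‖hcpSite a h q - hcpSite a h p‖ ^ 2)⁻¹) ^ 5)) *
              (inner ℝ (hcpSite a h q - hcpSite a h p) (u q - u p)) ^ 2))) +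
      (∑' q : ℤ × ℤ × ℤ, (if q = p then (0 : ℝ) else
          ∑ s ∈ Y, ∑ s' ∈ Y,
            (M (decide (Even p.1)) (q - p) s s' *
                (inner ℝ (hcpSite a h (p + s) - hcpSite a h p) (u (p + s) - u p) *
                  inner ℝ (hcpSite a h (p + s') - hcpSite a h p) (u (p + s') - u p)) -
              M (decide (Even q.1)) (p - q) s s' *
                (inner ℝ (hcpSite a h (q + s) - hcpSite a h q) (u (q + s) - u q) *
                  inner ℝ (hcpSite a h (q + s') - hcpSite a h q) (u (q + s') - u q)) +
              (N (decide (Even p.1)) (q - p) s s' - N (decide (Even q.1)) (p - q) s' s) *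
                (inner ℝ (hcpSite a h (p + s) - hcpSite a h p) (u (p + s) - u p) *
                  inner ℝ (hcpSite a h (q + s') - hcpSite a h q) (u (q + s') - u q)))))

/-- The recentred form implies the free-translation form (take `c = 0`). -/
theorem coreSitewiseCoercive_of_shell {a h κ : ℝ} :
    CoreShellCoercive a h κ → CoreSitewiseCoercive a h κ := by
  rintro ⟨C, Y, M, N, hY, hdec, hu⟩
  refine ⟨C, Y, M, N, hY, hdec, fun u hfin p => ?_⟩
  obtain ⟨W, hW, hle⟩ := hu u hfin p
  refine ⟨0, W, hW, ?_⟩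
  simpa only [sub_zero] using hle

/-- H2″ is antitone in its constant. -/
theorem coreShellCoercive_mono {a h κ κ' : ℝ} (hκ : κ' ≤ κ) :
    CoreShellCoercive a h κ → CoreShellCoercive a h κ' := by
  rintro ⟨C, Y, M, N, hY, hdec, hu⟩
  refine ⟨C, Y, M, N, hY, hdec, fun u hfin p => ?_⟩
  obtain ⟨W, hW, hle⟩ := hu u hfin p
  refine ⟨W, hW, le_trans ?_ hle⟩
  have hnn : 0 ≤ ∑' q : ℤ × ℤ × ℤ,
      (if 0 < ‖hcpSite a h q - hcpSite a h p‖ ∧ ‖hcpSite a h q - hcpSite a h p‖ ≤ 11 / 10 * a then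
        ‖u q - u p - W (hcpSite a h q - hcpSite a h p)‖ ^ 2 else (0 : ℝ)) :=
    tsum_nonneg fun q => by split_ifs <;> positivity
  exact mul_le_mul_of_nonneg_right hκ hnn

/-- **H3″ — the quantitative assembly from the RECENTRED coercivity** (the registered form of H3 after reshape
r4): H1 ∧ H2″(κ₀) at the family minimiser ⇒ the core for tolerances `η₀ ≤ a/N₀`.  Line-internal proof obligation
(stub `stub_coreShellAssembly`). [folklore] -/
def CoreShellAssembly (κ₀ N₀ a h : ℝ) : Prop :=
  0 < a → 0 < h → HcpFamilyMin a h → CoreFirstOrderDesign a h → CoreShellCoercive a h κ₀ →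
    ∀ δ : ℝ, 0 < δ → ∀ t η₀ : ℝ, |t| ≤ 1 / 100 → h = (1 + t) * a * Real.sqrt (2 / 3) →
      ∀ (ha : a ≠ 0) (hh : h ≠ 0), 0 < η₀ → η₀ ≤ a / N₀ →
        PerturbativeCore δ a t η₀ ((hcpPeriodicConfiguration ha hh).energyPerParticle lennardJones)

/-- An assembly from the weaker (free-translation) coercivity is an assembly from the recentred one. -/
theorem coreShellAssembly_of_Q {κ₀ N₀ a h : ℝ} :
    CoreAssemblyQ κ₀ N₀ a h → CoreShellAssembly κ₀ N₀ a h :=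
  fun hQ ha hh hfam h1 h2 => hQ ha hh hfam h1 (coreSitewiseCoercive_of_shell h2)

/-- **Registered anchor `stub_perturbativeCoreOfShellPieces` (reshape r4, recentred): the core from H1, H2″(κ₀)
and H3″(κ₀, N₀), at tolerance fraction `1/N₀`.** -/
theorem stub_perturbativeCoreOfShellPieces : ∀ κ₀ N₀ : ℝ,
    (∀ a h : ℝ, 0 < a → 0 < h → HcpFamilyMin a h → CoreFirstOrderDesign a h) →
    (∀ a h : ℝ, 0 < a → 0 < h → HcpFamilyMin a h → CoreShellCoercive a h κ₀) →
    (∀ a h : ℝ, CoreShellAssembly κ₀ N₀ a h) →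
    ∀ δ : ℝ, 0 < δ → ∀ a h t η₀ : ℝ, 0 < a → |t| ≤ 1 / 100 →
      h = (1 + t) * a * Real.sqrt (2 / 3) → HcpFamilyMin a h → ∀ (ha : a ≠ 0) (hh : h ≠ 0),
        0 < η₀ → η₀ ≤ a / N₀ →
          PerturbativeCore δ a t η₀ ((hcpPeriodicConfiguration ha hh).energyPerParticle lennardJones) := by
  intro κ₀ N₀ h1 h2 h3 δ hδ a h t η₀ ha ht hht hfam ha' hh' hη₀ hη
  have hpos : 0 < h := by
    have h1t : 0 < 1 + t := by have := (abs_le.1 ht).1; linarith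
    rw [hht]
    exact mul_pos (mul_pos h1t ha) (Real.sqrt_pos.2 (by norm_num))
  exact h3 a h ha hpos hfam (h1 a h ha hpos hfam) (h2 a h ha hpos hfam) δ hδ t η₀ ht hht ha' hh' hη₀ hη

end Summit.AtomisticToContinuum.Crystallization.Theorems.StrictSplittingRuleBirth

end
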